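import Mathlib
import Literature.Geometry.Symplectic.JHolomorphicFlatUniqueContinuationProofs
import HarnessLib

/-!
# Strong unique continuation for flat `J`-holomorphic discs (McDuff 1991, Lemma 2.3)

D. McDuff, *The local behaviour of holomorphic curves in almost complex 4-manifolds*,
J. Differential Geom. 34 (1991), **Lemma 2.3** (p. 147): *"If two `J`-holomorphic curves
`f, f' : Σ → (V, J)` have the same `∞`-jet at a point `z` of a connected Riemann surface `Σ`, then
`f = f'`"* — proved there from the coordinate form (2.3.1) of the equation and N. Aronszajn's
strong unique continuation theorem (J. Math. Pures Appl. 36 (1957), Remark 3). This is the first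
step of the local theory of critical points of `J`-holomorphic curves (McDuff §2: Prop. 2.6, the
normal form at a critical point, starts with "it follows from Lemma 2.3 that this [Taylor]
expansion is not identically zero"; C. Wendl, *Lectures on Contact 3-Manifolds, Holomorphic Curves
and Intersection Theory* (2020), App. B, Prop. B.26 and Thm. B.23 obtain the same finiteness of the
critical order from the similarity principle for systems), and hence of every route to the named
fact `Literature.Geometry.Symplectic.jHolomorphic_immersed_of_limitEmbedded_punctured`
(McDuff Thm 1.4 / Cor. 4.4) and to the representation formula behind
`Literature.Geometry.Symplectic.jHolomorphic_localBranchDichotomy`.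

The sibling file `JHolomorphicFlatUniqueContinuationProofs.lean` proves the WEAK form (vanishing on
an open set) by T. Carleman's weighted `L²` method for the first-order system `∂ₓ + J ∂ᵧ` with the
bounded weights `(κ + ‖z - b‖²)⁻¹`. This file proves the STRONG form (vanishing to infinite order
at one point) by the same method with the logarithmic weights
`ψ = -½ log(κ + ‖z - z₀‖²) + ‖z - z₀‖²`, `e^{2nψ} = (κ + ‖z - z₀‖²)^{-n} e^{2n‖z - z₀‖²}`
(`κ = ε⁴ → 0`), which is Carleman's original setting (T. Carleman, Ark. Mat. Astr. Fys. 26B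
(1939) no. 17: strong uniqueness for first-order elliptic systems in two variables). Everything is
proved; there are no definitions and no named facts.

## Contents (namespace `Literature.Geometry.Symplectic.FlatUniqueContinuation`)

* `carleman_weighted_bound` — the Carleman estimate of the sibling file with the zeroth-order term
  absorbed and a general weighted error: `τ μ ∫ e^{2τφ} N(f) ≤ ∫ e^{2τφ} E` whenever
  `N(∂ₓf + J∂ᵧf) ≤ a ‖f‖² + E`, `Δφ ≥ μ` on `supp f`, `a ≤ τμ`.
* `lap_logWeight` (`Δψ = 4 - 2κ(κ + ‖z - b‖²)⁻²` for the weight `ψ` written out as a lambda),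
  `two_le_lap_logWeight` (`Δψ ≥ 2` where `‖z - b‖⁴ ≥ κ`), `logWeight_ge` / `logWeight_le`
  (level comparisons).
* `exists_scaledBump_fderiv_bound` — cut-offs at scale `ε` with `‖Dχ_ε‖ ≤ C/ε` (rescalings of
  one reference bump).
* `key_estimate` — Carleman for `χ_out (1 - χ_ε) w`: the weighted mass of `w` on the annulus
  `r₁ ≤ ‖z - z₀‖ ≤ ρ/8` is bounded by the outer cut-off error (weight level
  `ℓₒ = -log(ρ/2) + ρ²`) plus the inner one (level `≤ 1 - log ε`, size `O((C_N (2ε)^N/ε)²)`);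
  `annulus_mass_le` — with `N = n + 2` the inner error is `O(ε²) → 0`, and `ℓₒ ≤ ℓ_A`
  (`outer_le_inner_level`, i.e. `ρ² ≤ (3/2) log 2`) leaves `2n · mass ≤ K` with `K` independent
  of `n`;
* `eq_zero_on_ball_of_flat` — **strong unique continuation** for `C²` solutions of
  `‖∂ₓw + J∂ᵧw‖ ≤ M ‖w‖` on a disc: infinite-order vanishing at one point forces `w ≡ 0`
  (the mass of every annulus about the point is `O(1/n)`, hence zero; then the weak theorem
  `eq_zero_on_ball` of the sibling file);
* `jHolomorphicFlat_eq_of_vanish_infiniteOrder` — **McDuff's Lemma 2.3, flat form**: a `C^∞`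
  `Jc`-holomorphic disc (smooth field of complex structures `Jc` on an open set of a real inner
  product space) which agrees to infinite order with the constant `u z₀` at `z₀` is constant.

Design: as in the sibling file, real inner-product-space valued maps and `J`-invariant quadratic
form `N`; only `C²` regularity of `u` and `C¹` of `Jc` are used. The flatness hypothesis is the
elementary `∀ N, ‖u z - u z₀‖ ≤ C_N ‖z - z₀‖^N` near `z₀` (for `C^∞` maps this is the vanishing
of all derivatives at `z₀`, by Taylor's theorem; that translation is left to the consumers).
Deliberately NOT here: the order of vanishing and the holomorphic leading term `a (z - z₀)^k`
(McDuff Prop. 2.6, first paragraph), two-curve versions, the similarity principle.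

## References

* D. McDuff, *The local behaviour of holomorphic curves in almost complex 4-manifolds*,
  J. Differential Geom. 34 (1991) 143–164, Lemma 2.3 and (2.3.1), Prop. 2.6.
  [McDuff1991LocalBehaviour]
* T. Carleman, *Sur un problème d'unicité pour les systèmes d'équations aux dérivées partielles à
  deux variables indépendantes*, Ark. Mat. Astr. Fys. 26B (1939), no. 17, 1–9. [Carleman1939Unicite]
* N. Aronszajn, *A unique continuation theorem for solutions of elliptic partial differential
  equations or inequalities of second order*, J. Math. Pures Appl. 36 (1957) 235–249.
* C. Wendl, *Lectures on Contact 3-Manifolds, Holomorphic Curves and Intersection Theory*,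
  Cambridge Tracts in Math. 220 (2020), App. B, Thm. B.20, Prop. B.26. [Wendl2020]
-/

noncomputable section

open scoped InnerProductSpace ContDiff
open Set Filter Topology MeasureTheory Metric

namespace Literature.Geometry.Symplectic

namespace FlatUniqueContinuation

variable {V : Type*} [NormedAddCommGroup V] [InnerProductSpace ℝ V]

/-! ### The Carleman estimate with a general weighted error -/

/-- **Weighted Carleman bound.** If `f ∈ C²_c` satisfies `N(∂ₓf + J∂ᵧf) ≤ a ‖f‖² + E` with a
continuous compactly supported error `E`, and the weight `φ ∈ C²` has `Δφ ≥ μ > 0` on the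
support of `f`, then for `τ > 0` with `a ≤ τ μ`,
`τ μ ∫ e^{2τφ} N(f) ≤ ∫ e^{2τφ} E` (the Carleman estimate `carleman_estimate`, with the
zeroth-order term absorbed). [folklore] -/
theorem carleman_weighted_bound {J : V →L[ℝ] V} (hJ : ∀ v, J (J v) = -v) {φ : ℂ → ℝ}
    {f : ℂ → V} {E : ℂ → ℝ} {a μ τ : ℝ} (hφ : ContDiff ℝ 2 φ) (hf : ContDiff ℝ 2 f)
    (hfc : HasCompactSupport f) (hE : Continuous E) (hEc : HasCompactSupport E)
    (ha : 0 ≤ a) (hlap : ∀ z, f z ≠ 0 → μ ≤ lap φ z)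
    (hineq : ∀ z, Nf J (Dop J f z) ≤ a * ‖f z‖ ^ 2 + E z) (hτ0 : 0 < τ) (hτa : a ≤ τ * μ) :
    τ * μ * ∫ z, Real.exp (2 * τ * φ z) * Nf J (f z) ≤
      ∫ z, Real.exp (2 * τ * φ z) * E z := by
  have hK : IsCompact (tsupport f) := hfc
  have hfz : ∀ z, z ∉ tsupport f → f z = 0 := fun z hz => image_eq_zero_of_notMem_tsupport hz
  have hfx : ∀ z, z ∉ tsupport f → dX f z = 0 := fun z hz => dX_eq_zero_of_notMem hz
  have hfy : ∀ z, z ∉ tsupport f → dY f z = 0 := fun z hz => dY_eq_zero_of_notMem hz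
  have cs : ∀ (F : ℂ → ℝ), (∀ z, z ∉ tsupport f → F z = 0) → HasCompactSupport F :=
    fun F hF => HasCompactSupport.intro hK hF
  have cf : Continuous f := hf.continuous
  have cφ : Continuous φ := hφ.continuous
  have cNf : Continuous fun z => Nf J (f z) := continuous_Nf J cf
  have cND : Continuous fun z => Nf J (Dop J f z) :=
    continuous_Nf J ((continuous_dX hf).add (J.continuous.comp (continuous_dY hf)))
  have clap : Continuous (lap φ) :=
    (((contDiff_one_dX hφ).continuous_fderiv one_ne_zero).clm_apply continuous_const).add
      (((contDiff_one_dY hφ).continuous_fderiv one_ne_zero).clm_apply continuous_const)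
  have ce : Continuous fun z => Real.exp (2 * τ * φ z) := (continuous_const.mul cφ).rexp
  have sNf : ∀ z, z ∉ tsupport f → Nf J (f z) = 0 := fun z hz => by simp [hfz z hz, Nf_eq]
  set X : ℝ := ∫ z, Real.exp (2 * τ * φ z) * Nf J (f z) with hX
  have iX : Integrable fun z => Real.exp (2 * τ * φ z) * Nf J (f z) :=
    (ce.mul cNf).integrable_of_hasCompactSupport (cs _ fun z hz => by simp [sNf z hz])
  have hX0 : 0 ≤ X := integral_nonneg fun z => mul_nonneg (Real.exp_pos _).le (Nf_nonneg J _)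
  have hcar := carleman_estimate hJ hφ hf hfc τ
  -- lower bound of the left-hand side
  have iL : Integrable fun z => lap φ z * (Real.exp (2 * τ * φ z) * Nf J (f z)) :=
    (clap.mul (ce.mul cNf)).integrable_of_hasCompactSupport
      (cs _ fun z hz => by simp [sNf z hz])
  have hlow : μ * X ≤ ∫ z, lap φ z * (Real.exp (2 * τ * φ z) * Nf J (f z)) := by
    rw [hX, ← integral_const_mul]
    refine integral_mono (iX.const_mul μ) iL fun z => ?_
    by_cases hz : f z = 0
    · simp [hz, Nf_eq]
    · exact mul_le_mul_of_nonneg_right (hlap z hz)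
        (mul_nonneg (Real.exp_pos _).le (Nf_nonneg J _))
  -- upper bound of the right-hand side
  have iR : Integrable fun z => Real.exp (2 * τ * φ z) * Nf J (Dop J f z) :=
    (ce.mul cND).integrable_of_hasCompactSupport
      (cs _ fun z hz => by simp [hfx z hz, hfy z hz, Dop, Nf_eq])
  have iE' : Integrable fun z => Real.exp (2 * τ * φ z) * E z :=
    (ce.mul hE).integrable_of_hasCompactSupport hEc.mul_left
  have hup : ∫ z, Real.exp (2 * τ * φ z) * Nf J (Dop J f z) ≤
      a * X + ∫ z, Real.exp (2 * τ * φ z) * E z := by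
    rw [hX, ← integral_const_mul, ← integral_add (iX.const_mul a) iE']
    refine integral_mono iR ((iX.const_mul a).add iE') fun z => ?_
    have h2 : Real.exp (2 * τ * φ z) * Nf J (Dop J f z) ≤
        Real.exp (2 * τ * φ z) * (a * Nf J (f z) + E z) := by
      refine mul_le_mul_of_nonneg_left ?_ (Real.exp_pos _).le
      have := sq_norm_le_Nf J (f z)
      nlinarith [hineq z]
    nlinarith [h2, Real.exp_pos (2 * τ * φ z)]
  -- combine
  have h1 : 2 * τ * (μ * X) ≤ a * X + ∫ z, Real.exp (2 * τ * φ z) * E z :=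
    le_trans (by nlinarith [hlow, hτ0.le]) (le_trans hcar hup)
  have h2 : a * X ≤ τ * μ * X := mul_le_mul_of_nonneg_right hτa hX0
  nlinarith

/-! ### The logarithmic weight `ψ(z) = -½ log(κ + ‖z - b‖²) + ‖z - b‖²` -/

section LogWeight

/-! The Carleman weight for strong unique continuation at `b` is
`ψ(z) = -½ log(κ + ‖z - b‖²) + ‖z - b‖²`, i.e. `e^{2τψ} = (κ + ‖z - b‖²)^{-τ} e^{2τ‖z-b‖²}`;
smooth for `κ > 0`, `≈ -log ‖z - b‖` as `κ → 0`, with `Δψ = 4 - 2κ (κ + ‖z - b‖²)⁻²`. It is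
written out as an explicit lambda in every statement (no definition is introduced). -/

variable (b : ℂ) {κ : ℝ} (hκ : 0 < κ)
include hκ

/-- The logarithmic weight is smooth for `κ > 0`. [folklore] -/
theorem contDiff_logWeight {n : WithTop ℕ∞} :
    ContDiff ℝ n (fun z : ℂ => -(1 / 2) * Real.log (κ + ‖z - b‖ ^ 2) + ‖z - b‖ ^ 2) := by
  have h1 : ContDiff ℝ n fun z : ℂ => κ + ‖z - b‖ ^ 2 :=
    contDiff_const.add ((contDiff_id.sub contDiff_const).norm_sq ℝ)
  have h2 : ContDiff ℝ n fun z : ℂ => ‖z - b‖ ^ 2 := (contDiff_id.sub contDiff_const).norm_sq ℝ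
  exact (contDiff_const.mul (h1.log fun z => (weight_den_pos b hκ z).ne')).add h2

/-- `Dψ(z) v = (2 - φ(z)) ⟪z - b, v⟫` with `φ = weight b κ`. [folklore] -/
theorem hasFDerivAt_logWeight (z : ℂ) :
    HasFDerivAt
      (fun z : ℂ => -(1 / 2) * Real.log (κ + ‖z - b‖ ^ 2) + ‖z - b‖ ^ 2)
        ((2 - weight b κ z) • innerSL ℝ (z - b)) z := by
  have hden := hasFDerivAt_den b κ z
  have hne : κ + ‖z - b‖ ^ 2 ≠ 0 := (weight_den_pos b hκ z).ne'
  have hlog := hden.log hne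
  have hsq : HasFDerivAt (fun y : ℂ => ‖y - b‖ ^ 2) (2 • innerSL ℝ (z - b)) z := by
    have h := ((hasFDerivAt_id z).sub_const b).norm_sq
    refine h.congr_fderiv ?_
    ext v
    simp [innerSL_apply_apply]
  have h := (hlog.const_mul (-(1 / 2) : ℝ)).add hsq
  refine h.congr_fderiv ?_
  ext v
  simp only [add_apply, FunLike.coe_smul, Pi.smul_apply, smul_eq_mul, innerSL_apply_apply,
    weight]
  ring

/-- `Dψ(z) v` evaluated. [folklore] -/
theorem fderiv_logWeight (z v : ℂ) :
    fderiv ℝ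
      (fun z : ℂ => -(1 / 2) * Real.log (κ + ‖z - b‖ ^ 2) + ‖z - b‖ ^ 2)
        z v = (2 - weight b κ z) * ⟪z - b, v⟫_ℝ := by
  rw [(hasFDerivAt_logWeight b hκ z).fderiv]
  simp only [FunLike.coe_smul, Pi.smul_apply, smul_eq_mul, innerSL_apply_apply]

/-- `∂ₓψ(z) = (2 - φ z) re(z - b)`. [folklore] -/
theorem dX_logWeight :
    dX
      (fun z : ℂ => -(1 / 2) * Real.log (κ + ‖z - b‖ ^ 2) + ‖z - b‖ ^ 2)
        = fun z => (2 - weight b κ z) * (z - b).re := by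
  funext z; simp only [dX, fderiv_logWeight b hκ, real_inner_one_right]

/-- `∂ᵧψ(z) = (2 - φ z) im(z - b)`. [folklore] -/
theorem dY_logWeight :
    dY
      (fun z : ℂ => -(1 / 2) * Real.log (κ + ‖z - b‖ ^ 2) + ‖z - b‖ ^ 2)
        = fun z => (2 - weight b κ z) * (z - b).im := by
  funext z; simp only [dY, fderiv_logWeight b hκ, real_inner_I_right]

/-- `∂ₓ∂ₓψ = 2 - φ + 2 re(z - b)² φ²`. [folklore] -/
theorem dX_dX_logWeight (z : ℂ) :
    dX (dX
      (fun z : ℂ => -(1 / 2) * Real.log (κ + ‖z - b‖ ^ 2) + ‖z - b‖ ^ 2)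
        ) z = 2 - weight b κ z + 2 * (z - b).re ^ 2 * weight b κ z ^ 2 := by
  rw [dX_logWeight b hκ]
  have hw := hasFDerivAt_weight b hκ z
  have h1 : HasFDerivAt (fun y : ℂ => 2 - weight b κ y) (-fderiv ℝ (weight b κ) z) z :=
    hw.const_sub 2
  have h2 := h1.fun_mul (hasFDerivAt_re_sub b z)
  simp only [dX]
  rw [h2.fderiv]
  simp only [add_apply, FunLike.coe_smul, Pi.smul_apply, smul_eq_mul, Complex.reCLM_apply,
    Complex.one_re, neg_apply, fderiv_weight b hκ, real_inner_one_right]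
  ring

/-- `∂ᵧ∂ᵧψ = 2 - φ + 2 im(z - b)² φ²`. [folklore] -/
theorem dY_dY_logWeight (z : ℂ) :
    dY (dY
      (fun z : ℂ => -(1 / 2) * Real.log (κ + ‖z - b‖ ^ 2) + ‖z - b‖ ^ 2)
        ) z = 2 - weight b κ z + 2 * (z - b).im ^ 2 * weight b κ z ^ 2 := by
  rw [dY_logWeight b hκ]
  have hw := hasFDerivAt_weight b hκ z
  have h1 : HasFDerivAt (fun y : ℂ => 2 - weight b κ y) (-fderiv ℝ (weight b κ) z) z :=
    hw.const_sub 2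
  have h2 := h1.fun_mul (hasFDerivAt_im_sub b z)
  simp only [dY]
  rw [h2.fderiv]
  simp only [add_apply, FunLike.coe_smul, Pi.smul_apply, smul_eq_mul, Complex.imCLM_apply,
    Complex.I_im, neg_apply, fderiv_weight b hκ, real_inner_I_right]
  ring

/-- `Δψ = 4 - 2κ φ²` (`φ = (κ + ‖z - b‖²)⁻¹`). [folklore] -/
theorem lap_logWeight (z : ℂ) :
    lap
      (fun z : ℂ => -(1 / 2) * Real.log (κ + ‖z - b‖ ^ 2) + ‖z - b‖ ^ 2)
        z = 4 - 2 * κ * weight b κ z ^ 2 := by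
  rw [lap, dX_dX_logWeight b hκ, dY_dY_logWeight b hκ]
  have hs : ‖z - b‖ ^ 2 = (z - b).re ^ 2 + (z - b).im ^ 2 := by
    rw [Complex.sq_norm, Complex.normSq_apply]; ring
  have hq : weight b κ z * (κ + ‖z - b‖ ^ 2) = 1 :=
    inv_mul_cancel₀ (weight_den_pos b hκ z).ne'
  rw [hs] at hq
  linear_combination (2 * weight b κ z) * hq

/-- On `{‖z - b‖⁴ ≥ κ}` the weight is strictly subharmonic: `Δψ ≥ 2`. [folklore] -/
theorem two_le_lap_logWeight {z : ℂ} (h : κ ≤ ‖z - b‖ ^ 4) :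
    2 ≤ lap (fun z : ℂ => -(1 / 2) * Real.log (κ + ‖z - b‖ ^ 2) + ‖z - b‖ ^ 2) z := by
  rw [lap_logWeight b hκ]
  have hs0 : 0 < ‖z - b‖ := by
    by_contra h0
    push Not at h0
    have : ‖z - b‖ = 0 := le_antisymm h0 (norm_nonneg _)
    rw [this] at h
    norm_num at h
    linarith
  have hden : 0 < κ + ‖z - b‖ ^ 2 := weight_den_pos b hκ z
  have hw : weight b κ z ≤ (‖z - b‖ ^ 2)⁻¹ := by
    rw [weight]; exact inv_anti₀ (by positivity) (by linarith)
  have hw0 : 0 ≤ weight b κ z := (weight_pos b hκ z).le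
  have h2 : weight b κ z ^ 2 ≤ (‖z - b‖ ^ 2)⁻¹ ^ 2 := pow_le_pow_left₀ hw0 hw 2
  have h3 : κ * weight b κ z ^ 2 ≤ 1 := by
    have e1 : (‖z - b‖ ^ 2)⁻¹ ^ 2 = (‖z - b‖ ^ 4)⁻¹ := by
      rw [inv_pow, ← pow_mul]
    rw [e1] at h2
    have h4 : κ * (‖z - b‖ ^ 4)⁻¹ ≤ 1 := by
      rw [← div_eq_mul_inv, div_le_one (by positivity)]; exact h
    exact (mul_le_mul_of_nonneg_left h2 hκ.le).trans h4
  linarith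

/-- Lower bound near the centre: for `‖z - b‖ ≤ r₀` and `κ ≤ r₀²`, `-½ log(2 r₀²) ≤ ψ(z)`.
[folklore] -/
theorem logWeight_ge {z : ℂ} {r₀ : ℝ} (hκr : κ ≤ r₀ ^ 2) (hz : ‖z - b‖ ≤ r₀) :
    -(1 / 2) * Real.log (2 * r₀ ^ 2) ≤ -(1 / 2) * Real.log (κ + ‖z - b‖ ^ 2) + ‖z - b‖ ^ 2 := by
  have h1 : κ + ‖z - b‖ ^ 2 ≤ 2 * r₀ ^ 2 := by
    nlinarith [pow_le_pow_left₀ (norm_nonneg _) hz 2]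
  have h2 : Real.log (κ + ‖z - b‖ ^ 2) ≤ Real.log (2 * r₀ ^ 2) :=
    Real.log_le_log (weight_den_pos b hκ z) h1
  nlinarith [sq_nonneg ‖z - b‖]

/-- Upper bound away from the centre: for `0 < r ≤ ‖z - b‖ ≤ R`, `ψ(z) ≤ -log r + R²`.
[folklore] -/
theorem logWeight_le {z : ℂ} {r R : ℝ} (hr : 0 < r) (hrz : r ≤ ‖z - b‖) (hzR : ‖z - b‖ ≤ R) :
    -(1 / 2) * Real.log (κ + ‖z - b‖ ^ 2) + ‖z - b‖ ^ 2 ≤ -Real.log r + R ^ 2 := by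
  have h1 : r ^ 2 ≤ κ + ‖z - b‖ ^ 2 := by
    nlinarith [pow_le_pow_left₀ hr.le hrz 2]
  have h2 : Real.log (r ^ 2) ≤ Real.log (κ + ‖z - b‖ ^ 2) := Real.log_le_log (by positivity) h1
  rw [Real.log_pow] at h2
  push_cast at h2
  nlinarith [pow_le_pow_left₀ (norm_nonneg _) hzR 2]

end LogWeight

/-! ### The inner cut-off at scale `ε` and its derivative bound -/

section InnerBump

/-- **Bumps at scale `ε` with derivative bound `C/ε`.** There is a constant `C ≥ 0` such that
for every centre `z₀` and every `ε > 0` some bump `χ_ε : ContDiffBump z₀` with `rIn = ε`,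
`rOut = 2ε` has `‖D χ_ε(y) v‖ ≤ (C/ε) ‖v‖` (all are rescalings `β(ε⁻¹(y - z₀))` of one reference
bump `β` with `rIn = 1`, `rOut = 2`, and `C = sup ‖Dβ‖`). [folklore] -/
theorem exists_scaledBump_fderiv_bound :
    ∃ C : ℝ, 0 ≤ C ∧ ∀ (z₀ : ℂ) (ε : ℝ), 0 < ε → ∃ χ : ContDiffBump z₀, χ.rIn = ε ∧
      χ.rOut = 2 * ε ∧ ∀ y v : ℂ, ‖fderiv ℝ (χ : ℂ → ℝ) y v‖ ≤ C / ε * ‖v‖ := by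
  let β : ContDiffBump (0 : ℂ) := ⟨1, 2, one_pos, by norm_num⟩
  have hβ : ContDiff ℝ 1 (β : ℂ → ℝ) := β.contDiff
  have hc : Continuous (fderiv ℝ (β : ℂ → ℝ)) := hβ.continuous_fderiv one_ne_zero
  have hs : HasCompactSupport (fderiv ℝ (β : ℂ → ℝ)) := β.hasCompactSupport.fderiv ℝ
  obtain ⟨C, hC⟩ := hc.bounded_above_of_compact_support hs
  refine ⟨max C 0, le_max_right _ _, fun z₀ ε hε => ?_⟩
  let χ : ContDiffBump z₀ := ⟨ε, 2 * ε, hε, by linarith⟩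
  refine ⟨χ, rfl, rfl, fun y v => ?_⟩
  -- `χ = β ∘ (y ↦ ε⁻¹ (y - z₀))`
  have heq : (χ : ℂ → ℝ) = (β : ℂ → ℝ) ∘ fun y : ℂ => (ε⁻¹ : ℝ) • (y - z₀) := by
    funext y
    rw [Function.comp_apply, ContDiffBump.apply, ContDiffBump.apply]
    have h1 : χ.rOut / χ.rIn = β.rOut / β.rIn := by
      show 2 * ε / ε = 2 / 1
      field_simp
    have h2 : χ.rIn⁻¹ • (y - z₀) = β.rIn⁻¹ • ((ε⁻¹ : ℝ) • (y - z₀) - 0) := by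
      show ε⁻¹ • (y - z₀) = (1 : ℝ)⁻¹ • ((ε⁻¹ : ℝ) • (y - z₀) - 0)
      simp
    rw [h1]
    exact congrArg _ h2
  have hA : HasFDerivAt (fun y : ℂ => (ε⁻¹ : ℝ) • (y - z₀))
      ((ε⁻¹ : ℝ) • ContinuousLinearMap.id ℝ ℂ) y :=
    ((hasFDerivAt_id (𝕜 := ℝ) y).sub_const z₀).const_smul (ε⁻¹ : ℝ)
  have hB : HasFDerivAt (β : ℂ → ℝ) (fderiv ℝ (β : ℂ → ℝ) ((ε⁻¹ : ℝ) • (y - z₀)))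
      ((ε⁻¹ : ℝ) • (y - z₀)) := (hβ.differentiable one_ne_zero _).hasFDerivAt
  have hcomp := hB.comp y hA
  rw [heq, hcomp.fderiv]
  simp only [ContinuousLinearMap.coe_comp, Function.comp_apply, FunLike.coe_smul,
    Pi.smul_apply, ContinuousLinearMap.coe_id', id_eq, map_smul, smul_eq_mul, norm_mul,
    norm_inv, Real.norm_eq_abs, abs_of_pos hε]
  have h1 := (fderiv ℝ (β : ℂ → ℝ) ((ε⁻¹ : ℝ) • (y - z₀))).le_opNorm v
  have h2 : ‖fderiv ℝ (β : ℂ → ℝ) ((ε⁻¹ : ℝ) • (y - z₀))‖ ≤ max C 0 :=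
    (hC _).trans (le_max_left _ _)
  have h3 : 0 ≤ ε⁻¹ := inv_nonneg.mpr hε.le
  calc ε⁻¹ * ‖fderiv ℝ (β : ℂ → ℝ) ((ε⁻¹ : ℝ) • (y - z₀)) v‖
      ≤ ε⁻¹ * (max C 0 * ‖v‖) :=
        mul_le_mul_of_nonneg_left (h1.trans (mul_le_mul_of_nonneg_right h2 (norm_nonneg _))) h3
    _ = max C 0 / ε * ‖v‖ := by rw [div_eq_mul_inv]; ring

end InnerBump

/-! ### The key estimate: Carleman with an outer and an inner cut-off -/

section Key

variable {J : V →L[ℝ] V}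

/-- The bound `‖D χ(y)‖` for a real cut-off controls `|∂ₓχ(y)|` and `|∂ᵧχ(y)|`. [folklore] -/
theorem abs_dX_le_of_fderiv_le {χ : ℂ → ℝ} {y : ℂ} {B : ℝ}
    (h : ∀ v : ℂ, ‖fderiv ℝ χ y v‖ ≤ B * ‖v‖) : |dX χ y| ≤ B ∧ |dY χ y| ≤ B := by
  constructor
  · have := h 1; simpa [dX] using this
  · have := h Complex.I; simpa [dY] using this

/-- Norm of the cut-off error `∂ₓχ • w + ∂ᵧχ • J w`. [folklore] -/
theorem norm_cutoff_error_le (J : V →L[ℝ] V) {χ : ℂ → ℝ} {w : ℂ → V} {y : ℂ} {B : ℝ}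
    (hB : 0 ≤ B) (h : ∀ v : ℂ, ‖fderiv ℝ χ y v‖ ≤ B * ‖v‖) :
    ‖dX χ y • w y + dY χ y • J (w y)‖ ≤ (1 + ‖J‖) * B * ‖w y‖ := by
  obtain ⟨hx, hy⟩ := abs_dX_le_of_fderiv_le h
  have h1 : ‖dX χ y • w y‖ ≤ B * ‖w y‖ := by
    rw [norm_smul, Real.norm_eq_abs]; exact mul_le_mul_of_nonneg_right hx (norm_nonneg _)
  have h2 : ‖dY χ y • J (w y)‖ ≤ B * (‖J‖ * ‖w y‖) := by
    rw [norm_smul, Real.norm_eq_abs]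
    exact mul_le_mul hy (J.le_opNorm _) (norm_nonneg _) hB
  calc ‖dX χ y • w y + dY χ y • J (w y)‖ ≤ B * ‖w y‖ + B * (‖J‖ * ‖w y‖) :=
        (norm_add_le _ _).trans (add_le_add h1 h2)
    _ = (1 + ‖J‖) * B * ‖w y‖ := by ring

/-- Monotonicity of the exponential weight in the exponent. [folklore] -/
theorem exp_weight_le {τ a b : ℝ} (hτ : 0 ≤ τ) (h : a ≤ b) :
    Real.exp (2 * τ * a) ≤ Real.exp (2 * τ * b) :=
  Real.exp_le_exp.mpr (mul_le_mul_of_nonneg_left h (by positivity))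

/-- One shell: where `‖Dχ‖ ≤ B`, `‖w‖ ≤ W` and `φ ≤ ℓ`, the weighted cut-off error is at most
`e^{2τℓ} · 2(1 + ‖J‖²)((1 + ‖J‖) B W)²`. [folklore] -/
theorem weighted_error_le (J : V →L[ℝ] V) {χ : ℂ → ℝ} {w : ℂ → V} {φ : ℂ → ℝ} {y : ℂ}
    {B W ℓ τ : ℝ} (hτ : 0 ≤ τ) (hB : 0 ≤ B) (hχ : ∀ v : ℂ, ‖fderiv ℝ χ y v‖ ≤ B * ‖v‖)
    (hw : ‖w y‖ ≤ W) (hφ : φ y ≤ ℓ) :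
    Real.exp (2 * τ * φ y) * (2 * (1 + ‖J‖ ^ 2) * ‖dX χ y • w y + dY χ y • J (w y)‖ ^ 2) ≤
      Real.exp (2 * τ * ℓ) * (2 * (1 + ‖J‖ ^ 2) * ((1 + ‖J‖) * B * W) ^ 2) := by
  have hey : ‖dX χ y • w y + dY χ y • J (w y)‖ ≤ (1 + ‖J‖) * B * W :=
    (norm_cutoff_error_le J hB hχ).trans (mul_le_mul_of_nonneg_left hw (by positivity))
  refine mul_le_mul (exp_weight_le hτ hφ) ?_ (by positivity) (Real.exp_pos _).le
  exact mul_le_mul_of_nonneg_left (pow_le_pow_left₀ (norm_nonneg _) hey 2) (by positivity)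

/-- Integrating a bound by two constant indicator functions of sets inside `closedBall z₀ 1`.
[folklore] -/
theorem integral_le_of_le_two_indicators {g : ℂ → ℝ} (hg : Integrable g) {z₀ : ℂ}
    {So Si : Set ℂ} (hSom : MeasurableSet So) (hSim : MeasurableSet Si)
    (hSo1 : So ⊆ closedBall z₀ 1) (hSi1 : Si ⊆ closedBall z₀ 1) {Ko Ki : ℝ} (hKo0 : 0 ≤ Ko)
    (hKi0 : 0 ≤ Ki)
    (hpt : ∀ y, g y ≤ So.indicator (fun _ => Ko) y + Si.indicator (fun _ => Ki) y) :
    ∫ y, g y ≤ (Ko + Ki) * (volume (closedBall z₀ (1 : ℝ))).toReal := by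
  have hfin : volume (closedBall z₀ (1 : ℝ)) ≠ ⊤ := measure_closedBall_lt_top.ne
  have hSofin : volume So ≠ ⊤ := ((measure_mono hSo1).trans_lt measure_closedBall_lt_top).ne
  have hSifin : volume Si ≠ ⊤ := ((measure_mono hSi1).trans_lt measure_closedBall_lt_top).ne
  have iKo : Integrable (So.indicator fun _ => Ko) :=
    (integrableOn_const hSofin).integrable_indicator hSom
  have iKi : Integrable (Si.indicator fun _ => Ki) :=
    (integrableOn_const hSifin).integrable_indicator hSim
  have h1 : ∫ y, g y ≤ ∫ y, (So.indicator (fun _ => Ko) y + Si.indicator (fun _ => Ki) y) :=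
    integral_mono hg (iKo.add iKi) hpt
  have h2 : ∫ y, (So.indicator (fun _ => Ko) y + Si.indicator (fun _ => Ki) y) =
      volume.real So * Ko + volume.real Si * Ki := by
    rw [integral_add iKo iKi, integral_indicator_const _ hSom, integral_indicator_const _ hSim]
    simp [smul_eq_mul]
  have h3 : volume.real So ≤ volume.real (closedBall z₀ (1 : ℝ)) := measureReal_mono hSo1 hfin
  have h4 : volume.real Si ≤ volume.real (closedBall z₀ (1 : ℝ)) := measureReal_mono hSi1 hfin
  rw [h2] at h1
  have h5 : volume.real So * Ko + volume.real Si * Ki ≤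
      (Ko + Ki) * volume.real (closedBall z₀ (1 : ℝ)) := by
    nlinarith [mul_le_mul_of_nonneg_right h3 hKo0, mul_le_mul_of_nonneg_right h4 hKi0]
  exact h1.trans h5

/-- Lower bound of a weighted integral by the mass on a set where the integrand is controlled
from below. [folklore] -/
theorem exp_mul_setIntegral_le {F G : ℂ → ℝ} {S : Set ℂ} (hS : MeasurableSet S)
    (hG : IntegrableOn G S) (hF : Integrable F) (hF0 : ∀ y, 0 ≤ F y) {c : ℝ}
    (h : ∀ y ∈ S, c * G y ≤ F y) : c * ∫ y in S, G y ≤ ∫ y, F y := by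
  have h1 : ∫ y in S, c * G y ≤ ∫ y in S, F y :=
    setIntegral_mono_on (hG.const_mul _) hF.integrableOn hS h
  have h2 : ∫ y in S, F y ≤ ∫ y, F y := setIntegral_le_integral hF (Eventually.of_forall hF0)
  rw [← integral_const_mul]
  exact h1.trans h2

set_option maxHeartbeats 800000 in
/-- **The key estimate.** Carleman's inequality for `χ w`, `χ = χ_out (1 - χ_ε)`, with the
logarithmic weight `ψ = -½ log(ε⁴ + ‖z - z₀‖²) + ‖z - z₀‖²`: the weighted mass of `w` on the
annulus `r₁ ≤ ‖z - z₀‖ ≤ ρ/8` is controlled by the outer cut-off error (weight `≤ e^{2nℓₒ}`) and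
the inner cut-off error at scale `ε` (weight `≤ (e/ε)^{2n}`, size `≤ (C (2ε)^N / ε)²` when
`‖w z‖ ≤ C ‖z - z₀‖^N`). [folklore] -/
theorem key_estimate (hJ : ∀ v, J (J v) = -v) {U : Set ℂ} (hU : IsOpen U) {w : ℂ → V}
    (hw : ContDiffOn ℝ 2 w U) {M : ℝ} (hM : ∀ z ∈ U, ‖Dop J w z‖ ≤ M * ‖w z‖)
    {z₀ : ℂ} {ρ : ℝ} (hρ : 0 < ρ) (hρ1 : ρ ≤ 1 / 2) (hρU : closedBall z₀ ρ ⊆ U)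
    {A : ℝ} (hA : ∀ z ∈ closedBall z₀ ρ, ‖w z‖ ≤ A)
    (χo : ContDiffBump z₀) (hχo1 : χo.rIn = ρ / 2) (hχo2 : χo.rOut = ρ)
    {Co : ℝ} (hCo0 : 0 ≤ Co) (hCo : ∀ y v, ‖fderiv ℝ (χo : ℂ → ℝ) y v‖ ≤ Co * ‖v‖)
    {Cβ : ℝ} (hCβ0 : 0 ≤ Cβ)
    (hCβ : ∀ ε : ℝ, 0 < ε → ∃ χ : ContDiffBump z₀, χ.rIn = ε ∧ χ.rOut = 2 * ε ∧
      ∀ y v : ℂ, ‖fderiv ℝ (χ : ℂ → ℝ) y v‖ ≤ Cβ / ε * ‖v‖)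
    (n : ℕ) (hn : 1 ≤ n) (hna : 2 * (1 + ‖J‖ ^ 2) * M ^ 2 ≤ 2 * n)
    {N : ℕ} {C δ : ℝ} (hC0 : 0 ≤ C) (hCN : ∀ z, ‖z - z₀‖ < δ → ‖w z‖ ≤ C * ‖z - z₀‖ ^ N)
    {ε r₁ : ℝ} (hε : 0 < ε) (hερ : ε ≤ ρ / 8) (hεr : 2 * ε ≤ r₁) (hεδ : 2 * ε < δ) :
    2 * n * Real.exp (2 * n * (-(1 / 2) * Real.log (2 * (ρ / 8) ^ 2))) *
        ∫ z in closedBall z₀ (ρ / 8) \ ball z₀ r₁, Nf J (w z) ≤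
      (Real.exp (2 * n * (-Real.log (ρ / 2) + ρ ^ 2)) *
          (2 * (1 + ‖J‖ ^ 2) * ((1 + ‖J‖) * Co * A) ^ 2) +
        Real.exp (2 * n * (-Real.log ε + 1)) *
          (2 * (1 + ‖J‖ ^ 2) * ((1 + ‖J‖) * (Cβ / ε) * (C * (2 * ε) ^ N)) ^ 2)) *
      (volume (closedBall z₀ 1)).toReal := by
  -- ### parameters
  have hn0 : (0 : ℝ) < n := by exact_mod_cast hn
  set κ : ℝ := ε ^ 4 with hκ_def
  have hκ0 : 0 < κ := by positivity
  -- ### the cut-offs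
  obtain ⟨χε, hχε1, hχε2, hχεd⟩ := hCβ ε hε
  set χ : ℂ → ℝ := fun y => χo y * (1 - χε y) with hχ_def
  have hχos : ContDiff ℝ 2 (χo : ℂ → ℝ) := χo.contDiff
  have hχεs : ContDiff ℝ 2 (χε : ℂ → ℝ) := χε.contDiff
  have hχs : ContDiff ℝ 2 χ := hχos.mul (contDiff_const.sub hχεs)
  have hχd : Differentiable ℝ χ := hχs.differentiable (by norm_num)
  have hχo0 : ∀ y, ρ ≤ dist y z₀ → χo y = 0 := fun y hy =>
    χo.zero_of_le_dist (by rwa [hχo2])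
  have hχ0 : ∀ y, y ∉ closedBall z₀ ρ → χ y = 0 := fun y hy => by
    rw [mem_closedBall, not_le] at hy
    simp [hχ_def, hχo0 y hy.le]
  have hχt : tsupport χ ⊆ closedBall z₀ ρ :=
    closure_minimal (fun y hy => by by_contra h; exact hy (hχ0 y h)) isClosed_closedBall
  have hχU : tsupport χ ⊆ U := hχt.trans hρU
  -- values of the cut-offs on the various regions
  have hχε_one : ∀ y, dist y z₀ ≤ ε → χε y = 1 := fun y hy =>
    χε.one_of_mem_closedBall (by rwa [mem_closedBall, hχε1])
  have hχε_zero : ∀ y, 2 * ε ≤ dist y z₀ → χε y = 0 := fun y hy =>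
    χε.zero_of_le_dist (by rwa [hχε2])
  have hχo_one : ∀ y, dist y z₀ ≤ ρ / 2 → χo y = 1 := fun y hy =>
    χo.one_of_mem_closedBall (by rwa [mem_closedBall, hχo1])
  have hdχε_ne : ∀ y, fderiv ℝ (χε : ℂ → ℝ) y ≠ 0 → ε ≤ dist y z₀ ∧ dist y z₀ ≤ 2 * ε :=
    fun y hy => by
    have := bump_rIn_le_dist_of_fderiv_ne_zero χε hy
    rwa [hχε1, hχε2] at this
  have hdχo_ne : ∀ y, fderiv ℝ (χo : ℂ → ℝ) y ≠ 0 → ρ / 2 ≤ dist y z₀ ∧ dist y z₀ ≤ ρ :=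
    fun y hy => by
    have := bump_rIn_le_dist_of_fderiv_ne_zero χo hy
    rwa [hχo1, hχo2] at this
  -- the derivative of `χ`
  have hdχ : ∀ y v, fderiv ℝ χ y v =
      (1 - χε y) * fderiv ℝ (χo : ℂ → ℝ) y v - χo y * fderiv ℝ (χε : ℂ → ℝ) y v := by
    intro y v
    have h1 : HasFDerivAt (χo : ℂ → ℝ) (fderiv ℝ (χo : ℂ → ℝ) y) y :=
      (hχos.differentiable (by norm_num) y).hasFDerivAt
    have h2 : HasFDerivAt (fun y => 1 - χε y) (-fderiv ℝ (χε : ℂ → ℝ) y) y :=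
      ((hχεs.differentiable (by norm_num) y).hasFDerivAt).const_sub 1
    rw [show χ = fun y => χo y * (1 - χε y) from rfl, (h1.fun_mul h2).fderiv]
    simp only [add_apply, FunLike.coe_smul, Pi.smul_apply, smul_eq_mul, neg_apply]
    ring
  have hdχ_in : ∀ y, fderiv ℝ (χε : ℂ → ℝ) y ≠ 0 →
      ∀ v, ‖fderiv ℝ χ y v‖ ≤ Cβ / ε * ‖v‖ := by
    intro y hy v
    obtain ⟨-, h2⟩ := hdχε_ne y hy
    have hoy : χo y = 1 := hχo_one y (by linarith)
    have hdo : fderiv ℝ (χo : ℂ → ℝ) y = 0 := by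
      by_contra h
      have := (hdχo_ne y h).1
      linarith
    rw [hdχ, hoy, hdo]
    simpa using hχεd y v
  have hdχ_out : ∀ y, fderiv ℝ (χo : ℂ → ℝ) y ≠ 0 →
      ∀ v, ‖fderiv ℝ χ y v‖ ≤ Co * ‖v‖ := by
    intro y hy v
    obtain ⟨h1, -⟩ := hdχo_ne y hy
    have hεy : χε y = 0 := hχε_zero y (by linarith)
    have hdε : fderiv ℝ (χε : ℂ → ℝ) y = 0 := by
      by_contra h
      have := (hdχε_ne y h).2
      linarith
    rw [hdχ, hεy, hdε]
    simpa using hCo y v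
  have hdχ_zero : ∀ y, fderiv ℝ (χo : ℂ → ℝ) y = 0 → fderiv ℝ (χε : ℂ → ℝ) y = 0 →
      fderiv ℝ χ y = 0 := by
    intro y h1 h2
    ext v
    rw [hdχ, h1, h2]
    simp
  -- ### the localised function, the weight, the error
  set f : ℂ → V := fun y => χ y • w y with hf_def
  have hf2 : ContDiff ℝ 2 f := contDiff_smul_of_tsupport_subset hU hχs hχU hw
  have hK : IsCompact (closedBall z₀ ρ) := isCompact_closedBall _ _
  have hfc : HasCompactSupport f := HasCompactSupport.intro hK fun y hy => by
    simp [hf_def, hχ0 y hy]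
  set ψ : ℂ → ℝ := fun z : ℂ => -(1 / 2) * Real.log (κ + ‖z - z₀‖ ^ 2) + ‖z - z₀‖ ^ 2
    with hψ_def
  have hφ : ContDiff ℝ 2 ψ := contDiff_logWeight z₀ hκ0
  set e : ℂ → V := fun y => dX χ y • w y + dY χ y • J (w y) with he_def
  have hwc : ContinuousOn w U := hw.continuousOn
  have hec : Continuous e := by
    refine (continuous_smul_of_tsupport_subset hU (continuous_dX hχs)
      ((tsupport_dX_subset _).trans hχU) hwc).add
      (continuous_smul_of_tsupport_subset hU (continuous_dY hχs)
        ((tsupport_dY_subset _).trans hχU) (J.continuous.comp_continuousOn hwc))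
  have hdχ0' : ∀ y, y ∉ closedBall z₀ ρ → fderiv ℝ χ y = 0 := fun y hy =>
    fderiv_of_notMem_tsupport ℝ fun h => hy (hχt h)
  set E : ℂ → ℝ := fun y => 2 * (1 + ‖J‖ ^ 2) * ‖e y‖ ^ 2 with hE_def
  have hEc : Continuous E := continuous_const.mul (hec.norm.pow 2)
  have hEs : HasCompactSupport E := HasCompactSupport.intro hK fun y hy => by
    simp [hE_def, he_def, dX, dY, hdχ0' y hy]
  have hE0 : ∀ y, 0 ≤ E y := fun y => by positivity
  -- the Leibniz rule: `D f = χ D w + e`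
  have hwd : DifferentiableOn ℝ w U := hw.differentiableOn (by norm_num)
  have hDf : ∀ y, Dop J f y = χ y • Dop J w y + e y := by
    intro y
    simp only [Dop, dX, dY, he_def, hf_def,
      fderiv_smul_apply_of_tsupport_subset hU hχd hχU hwd, map_add, map_smul, smul_add]
    abel
  -- the differential inequality for `f`
  have hineq : ∀ y, Nf J (Dop J f y) ≤ 2 * (1 + ‖J‖ ^ 2) * M ^ 2 * ‖f y‖ ^ 2 + E y := by
    intro y
    have h1 : ‖χ y • Dop J w y‖ ≤ M * ‖f y‖ := by
      by_cases hy : y ∈ U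
      · rw [hf_def, norm_smul, norm_smul, mul_left_comm]
        exact mul_le_mul_of_nonneg_left (hM y hy) (norm_nonneg _)
      · have : χ y = 0 := image_eq_zero_of_notMem_tsupport fun h => hy (hχU h)
        simp [this, hf_def]
    have h2 : ‖Dop J f y‖ ≤ M * ‖f y‖ + ‖e y‖ := by
      rw [hDf y]; exact (norm_add_le _ _).trans (by linarith)
    have := Nf_le_of_norm_le J h2
    simpa [hE_def] using this
  -- where `f ≠ 0` the weight is strictly subharmonic
  have hlap : ∀ y, f y ≠ 0 → (2 : ℝ) ≤ lap ψ y := by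
    intro y hy
    have hχy : χ y ≠ 0 := fun h => hy (by simp [hf_def, h])
    have hεy : ε < ‖y - z₀‖ := by
      by_contra h
      push Not at h
      have : χε y = 1 := hχε_one y (by rwa [dist_eq_norm])
      exact hχy (by simp [hχ_def, this])
    refine two_le_lap_logWeight z₀ hκ0 ?_
    rw [hκ_def]
    exact pow_le_pow_left₀ hε.le hεy.le 4
  -- ### Carleman
  have hcar := carleman_weighted_bound hJ hφ hf2 hfc hEc hEs (by positivity) hlap hineq hn0
    (by linarith)
  -- ### lower bound of the left-hand side: the annulus `r₁ ≤ ‖z - z₀‖ ≤ ρ/8`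
  set Ann : Set ℂ := closedBall z₀ (ρ / 8) \ ball z₀ r₁ with hAnn
  have hAnnm : MeasurableSet Ann := measurableSet_closedBall.diff measurableSet_ball
  have hχ_one : ∀ y ∈ Ann, χ y = 1 := by
    intro y hy
    rw [hAnn, Set.mem_sdiff, mem_closedBall, mem_ball, not_lt] at hy
    have h1 : χo y = 1 := hχo_one y (by linarith)
    have h2 : χε y = 0 := hχε_zero y (by linarith)
    simp [hχ_def, h1, h2]
  have hAnnU : Ann ⊆ U := fun y hy => hρU (closedBall_subset_closedBall (by linarith) hy.1)
  have hwAnn : ContinuousOn (fun y => Nf J (w y)) Ann :=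
    (continuous_Nf J continuous_id).comp_continuousOn (hwc.mono hAnnU)
  have hAnnc : IsCompact Ann := (isCompact_closedBall z₀ (ρ / 8)).diff isOpen_ball
  have iA : IntegrableOn (fun y => Nf J (w y)) Ann := hwAnn.integrableOn_compact hAnnc
  have cφ : Continuous (ψ) := hφ.continuous
  have ce : Continuous fun y => Real.exp (2 * n * ψ y) :=
    (continuous_const.mul cφ).rexp
  have cNf : Continuous fun y => Nf J (f y) := continuous_Nf J hf2.continuous
  have iX : Integrable fun y => Real.exp (2 * n * ψ y) * Nf J (f y) :=
    (ce.mul cNf).integrable_of_hasCompactSupport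
      (HasCompactSupport.intro hK fun y hy => by simp [hf_def, hχ0 y hy, Nf_eq])
  have hκr : κ ≤ (ρ / 8) ^ 2 := by
    have h1 : ε ^ 2 ≤ (ρ / 8) ^ 2 := pow_le_pow_left₀ hε.le hερ 2
    have h2 : ε ^ 2 ≤ 1 := by nlinarith
    calc κ = ε ^ 2 * ε ^ 2 := by rw [hκ_def]; ring
      _ ≤ ε ^ 2 * 1 := mul_le_mul_of_nonneg_left h2 (sq_nonneg _)
      _ ≤ (ρ / 8) ^ 2 := by linarith
  have hlow : Real.exp (2 * n * (-(1 / 2) * Real.log (2 * (ρ / 8) ^ 2))) *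
      ∫ y in Ann, Nf J (w y) ≤ ∫ y, Real.exp (2 * n * ψ y) * Nf J (f y) := by
    refine exp_mul_setIntegral_le hAnnm iA iX
      (fun y => mul_nonneg (Real.exp_pos _).le (Nf_nonneg J _)) fun y hy => ?_
    have hfy : f y = w y := by simp [hf_def, hχ_one y hy]
    rw [hfy]
    have h1 : ‖y - z₀‖ ≤ ρ / 8 := by
      have := hy.1
      rwa [mem_closedBall, dist_eq_norm] at this
    exact mul_le_mul_of_nonneg_right (exp_weight_le hn0.le (logWeight_ge z₀ hκ0 hκr h1))
      (Nf_nonneg J _)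
  -- ### upper bound of the right-hand side: the two shells
  set So : Set ℂ := closedBall z₀ ρ \ ball z₀ (ρ / 2) with hSo
  set Si : Set ℂ := closedBall z₀ (2 * ε) \ ball z₀ ε with hSi
  have hSom : MeasurableSet So := measurableSet_closedBall.diff measurableSet_ball
  have hSim : MeasurableSet Si := measurableSet_closedBall.diff measurableSet_ball
  have hSo1 : So ⊆ closedBall z₀ 1 := fun y hy =>
    closedBall_subset_closedBall (by linarith) hy.1
  have hSi1 : Si ⊆ closedBall z₀ 1 := fun y hy =>
    closedBall_subset_closedBall (by linarith) hy.1
  have hpt : ∀ y, Real.exp (2 * n * ψ y) * E y ≤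
      So.indicator (fun _ => Real.exp (2 * n * (-Real.log (ρ / 2) + ρ ^ 2)) *
          (2 * (1 + ‖J‖ ^ 2) * ((1 + ‖J‖) * Co * A) ^ 2)) y +
        Si.indicator (fun _ => Real.exp (2 * n * (-Real.log ε + 1)) *
          (2 * (1 + ‖J‖ ^ 2) * ((1 + ‖J‖) * (Cβ / ε) * (C * (2 * ε) ^ N)) ^ 2)) y := by
    intro y
    have hi0 : 0 ≤ So.indicator (fun _ => Real.exp (2 * n * (-Real.log (ρ / 2) + ρ ^ 2)) *
        (2 * (1 + ‖J‖ ^ 2) * ((1 + ‖J‖) * Co * A) ^ 2)) y :=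
      Set.indicator_nonneg (fun _ _ => by positivity) y
    have hi0' : 0 ≤ Si.indicator (fun _ => Real.exp (2 * n * (-Real.log ε + 1)) *
        (2 * (1 + ‖J‖ ^ 2) * ((1 + ‖J‖) * (Cβ / ε) * (C * (2 * ε) ^ N)) ^ 2)) y :=
      Set.indicator_nonneg (fun _ _ => by positivity) y
    rcases eq_or_ne (fderiv ℝ (χε : ℂ → ℝ) y) 0 with hε0 | hε0
    · rcases eq_or_ne (fderiv ℝ (χo : ℂ → ℝ) y) 0 with ho0 | ho0
      · -- no error here
        have : E y = 0 := by
          simp [hE_def, he_def, dX, dY, hdχ_zero y ho0 hε0]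
        rw [this, mul_zero]
        exact add_nonneg hi0 hi0'
      · -- the outer shell
        obtain ⟨h1, h2⟩ := hdχo_ne y ho0
        have hyo : y ∈ So := by
          rw [hSo, Set.mem_sdiff, mem_closedBall, mem_ball, not_lt]
          exact ⟨h2, h1⟩
        rw [Set.indicator_of_mem hyo]
        rw [dist_eq_norm] at h1 h2
        have h := weighted_error_le J (φ := ψ) hn0.le hCo0 (hdχ_out y ho0)
          (hA y (mem_closedBall.mpr (by rwa [dist_eq_norm])))
          (logWeight_le z₀ hκ0 (by positivity) h1 h2)
        exact h.trans (le_add_of_nonneg_right hi0')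
    · -- the inner shell
      obtain ⟨h1, h2⟩ := hdχε_ne y hε0
      have hyi : y ∈ Si := by
        rw [hSi, Set.mem_sdiff, mem_closedBall, mem_ball, not_lt]
        exact ⟨h2, h1⟩
      rw [Set.indicator_of_mem hyi]
      rw [dist_eq_norm] at h1 h2
      have hwy : ‖w y‖ ≤ C * (2 * ε) ^ N :=
        (hCN y (by linarith)).trans
          (mul_le_mul_of_nonneg_left (pow_le_pow_left₀ (norm_nonneg _) h2 N) hC0)
      have hφy : ψ y ≤ -Real.log ε + 1 := by
        have h3 := logWeight_le z₀ hκ0 hε h1 h2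
        have h4 : (2 * ε) ^ 2 ≤ 1 := by nlinarith
        show -(1 / 2) * Real.log (κ + ‖y - z₀‖ ^ 2) + ‖y - z₀‖ ^ 2 ≤ -Real.log ε + 1
        linarith
      have h := weighted_error_le J (φ := ψ) hn0.le (by positivity) (hdχ_in y hε0) hwy hφy
      exact h.trans (le_add_of_nonneg_left hi0)
  have iE : Integrable fun y => Real.exp (2 * n * ψ y) * E y :=
    (ce.mul hEc).integrable_of_hasCompactSupport hEs.mul_left
  have hup := integral_le_of_le_two_indicators iE hSom hSim hSo1 hSi1 (by positivity)
    (by positivity) hpt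
  -- ### combine
  calc 2 * n * Real.exp (2 * n * (-(1 / 2) * Real.log (2 * (ρ / 8) ^ 2))) *
        ∫ y in Ann, Nf J (w y)
      = 2 * n * (Real.exp (2 * n * (-(1 / 2) * Real.log (2 * (ρ / 8) ^ 2))) *
          ∫ y in Ann, Nf J (w y)) := by ring
    _ ≤ 2 * n * ∫ y, Real.exp (2 * n * ψ y) * Nf J (f y) :=
        mul_le_mul_of_nonneg_left hlow (by positivity)
    _ = n * 2 * ∫ y, Real.exp (2 * n * ψ y) * Nf J (f y) := by ring
    _ ≤ ∫ y, Real.exp (2 * n * ψ y) * E y := hcar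
    _ ≤ _ := hup

end Key

/-! ### Strong unique continuation -/

section Strong

variable {J : V →L[ℝ] V}

/-- `ℓₒ ≤ ℓ_A`: the weight on the outer shell is below the weight on the inner annulus,
`-log(ρ/2) + ρ² ≤ -½ log(2 (ρ/8)²)` for `0 < ρ ≤ 1/2` (this is `ρ² ≤ (3/2) log 2`). [folklore] -/
theorem outer_le_inner_level {ρ : ℝ} (hρ : 0 < ρ) (hρ1 : ρ ≤ 1 / 2) :
    -Real.log (ρ / 2) + ρ ^ 2 ≤ -(1 / 2) * Real.log (2 * (ρ / 8) ^ 2) := by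
  have h2 : Real.log (ρ / 2) = Real.log ρ - Real.log 2 := Real.log_div hρ.ne' two_ne_zero
  have h8 : Real.log (2 * (ρ / 8) ^ 2) = Real.log 2 + 2 * (Real.log ρ - 3 * Real.log 2) := by
    rw [Real.log_mul two_ne_zero (by positivity), Real.log_pow, Real.log_div hρ.ne' (by norm_num),
      show (8 : ℝ) = 2 ^ 3 by norm_num, Real.log_pow]
    push_cast
    ring
  rw [h2, h8]
  have hlog := Real.log_two_gt_d9
  nlinarith

set_option maxHeartbeats 800000 in
/-- **Mass bound on annuli.** Under the hypotheses of `key_estimate`, with `w` flat at `z₀`,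
letting `ε → 0` and using `outer_le_inner_level`:
`2n ∫_{r₁ ≤ ‖z - z₀‖ ≤ ρ/8} N(w) ≤ 2(1 + ‖J‖²)((1 + ‖J‖) Cₒ A)² vol(B̄(z₀, 1))` for all large `n`,
a bound independent of `n`. [folklore] -/
theorem annulus_mass_le (hJ : ∀ v, J (J v) = -v) {U : Set ℂ} (hU : IsOpen U) {w : ℂ → V}
    (hw : ContDiffOn ℝ 2 w U) {M : ℝ} (hM : ∀ z ∈ U, ‖Dop J w z‖ ≤ M * ‖w z‖)
    {z₀ : ℂ} {ρ : ℝ} (hρ : 0 < ρ) (hρ1 : ρ ≤ 1 / 2) (hρU : closedBall z₀ ρ ⊆ U)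
    {A : ℝ} (hA : ∀ z ∈ closedBall z₀ ρ, ‖w z‖ ≤ A)
    (χo : ContDiffBump z₀) (hχo1 : χo.rIn = ρ / 2) (hχo2 : χo.rOut = ρ)
    {Co : ℝ} (hCo0 : 0 ≤ Co) (hCo : ∀ y v, ‖fderiv ℝ (χo : ℂ → ℝ) y v‖ ≤ Co * ‖v‖)
    {Cβ : ℝ} (hCβ0 : 0 ≤ Cβ)
    (hCβ : ∀ ε : ℝ, 0 < ε → ∃ χ : ContDiffBump z₀, χ.rIn = ε ∧ χ.rOut = 2 * ε ∧
      ∀ y v : ℂ, ‖fderiv ℝ (χ : ℂ → ℝ) y v‖ ≤ Cβ / ε * ‖v‖)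
    (hflat : ∀ N : ℕ, ∃ C δ : ℝ, 0 < δ ∧ ∀ z, ‖z - z₀‖ < δ → ‖w z‖ ≤ C * ‖z - z₀‖ ^ N)
    (n : ℕ) (hn : 1 ≤ n) (hna : 2 * (1 + ‖J‖ ^ 2) * M ^ 2 ≤ 2 * n) {r₁ : ℝ} (hr₁ : 0 < r₁) :
    2 * n * ∫ z in closedBall z₀ (ρ / 8) \ ball z₀ r₁, Nf J (w z) ≤
      2 * (1 + ‖J‖ ^ 2) * ((1 + ‖J‖) * Co * A) ^ 2 * (volume (closedBall z₀ (1 : ℝ))).toReal := by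
  set I : ℝ := ∫ z in closedBall z₀ (ρ / 8) \ ball z₀ r₁, Nf J (w z) with hI
  set v₁ : ℝ := (volume (closedBall z₀ (1 : ℝ))).toReal with hv₁
  have hv₁0 : 0 ≤ v₁ := ENNReal.toReal_nonneg
  set ℓA : ℝ := -(1 / 2) * Real.log (2 * (ρ / 8) ^ 2) with hℓA
  set ℓo : ℝ := -Real.log (ρ / 2) + ρ ^ 2 with hℓo
  set K₁ : ℝ := 2 * (1 + ‖J‖ ^ 2) * ((1 + ‖J‖) * Co * A) ^ 2 with hK₁
  have hK₁0 : 0 ≤ K₁ := by positivity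
  have hn0 : (0 : ℝ) < n := by exact_mod_cast hn
  -- flatness of order `N = n + 2`
  obtain ⟨C, δ, hδ, hCN⟩ := hflat (n + 2)
  have hC0 : 0 ≤ max C 0 := le_max_right _ _
  have hCN' : ∀ z, ‖z - z₀‖ < δ → ‖w z‖ ≤ max C 0 * ‖z - z₀‖ ^ (n + 2) := fun z hz =>
    (hCN z hz).trans (mul_le_mul_of_nonneg_right (le_max_left _ _) (by positivity))
  set K₂ : ℝ := 2 * (1 + ‖J‖ ^ 2) * ((1 + ‖J‖) * Cβ * max C 0 * 2 ^ (n + 2)) ^ 2 *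
    Real.exp 1 ^ (2 * n) with hK₂
  have hK₂0 : 0 ≤ K₂ := by positivity
  -- the key estimate for every small `ε`, inner error rewritten as `K₂ ε²`
  have hkey : ∀ ε : ℝ, 0 < ε → ε ≤ ρ / 8 → 2 * ε ≤ r₁ → 2 * ε < δ →
      2 * n * Real.exp (2 * n * ℓA) * I ≤ (Real.exp (2 * n * ℓo) * K₁ + K₂ * ε ^ 2) * v₁ := by
    intro ε hε hερ hεr hεδ
    have h := key_estimate hJ hU hw hM hρ hρ1 hρU hA χo hχo1 hχo2 hCo0 hCo hCβ0 hCβ n hn hna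
      hC0 hCN' hε hερ hεr hεδ
    have e1 : Real.exp (2 * n * (-Real.log ε + 1)) = (Real.exp 1 / ε) ^ (2 * n) := by
      rw [show (2 * n * (-Real.log ε + 1) : ℝ) = ((2 * n : ℕ) : ℝ) * (1 - Real.log ε) by
        push_cast; ring, Real.exp_nat_mul, Real.exp_sub, Real.exp_log hε]
    have e2 : Real.exp (2 * n * (-Real.log ε + 1)) *
        (2 * (1 + ‖J‖ ^ 2) * ((1 + ‖J‖) * (Cβ / ε) * (max C 0 * (2 * ε) ^ (n + 2))) ^ 2) =
        K₂ * ε ^ 2 := by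
      rw [e1, hK₂, div_pow, mul_pow 2 ε]
      field_simp
      ring
    rw [e2] at h
    exact h
  -- let `ε → 0`
  have hlim : 2 * n * Real.exp (2 * n * ℓA) * I ≤ Real.exp (2 * n * ℓo) * K₁ * v₁ := by
    refine le_of_forall_pos_le_add fun η hη => ?_
    have hKv : 0 < K₂ * v₁ + 1 := by positivity
    set a : ℝ := min (ρ / 8) (r₁ / 2) with ha_def
    set b : ℝ := min (δ / 4) (min 1 (η / (K₂ * v₁ + 1))) with hb_def
    set ε : ℝ := min a b with hε_def
    have hε : 0 < ε :=
      lt_min (lt_min (by positivity) (by positivity))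
        (lt_min (by positivity) (lt_min one_pos (by positivity)))
    have hεa : ε ≤ a := min_le_left _ _
    have hεb : ε ≤ b := min_le_right _ _
    have hερ : ε ≤ ρ / 8 := hεa.trans (min_le_left _ _)
    have hεr : 2 * ε ≤ r₁ := by
      have : ε ≤ r₁ / 2 := hεa.trans (min_le_right _ _)
      linarith
    have hεδ : 2 * ε < δ := by
      have : ε ≤ δ / 4 := hεb.trans (min_le_left _ _)
      linarith
    have hε1 : ε ≤ 1 := hεb.trans ((min_le_right _ _).trans (min_le_left _ _))
    have hεη : ε ≤ η / (K₂ * v₁ + 1) :=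
      hεb.trans ((min_le_right _ _).trans (min_le_right _ _))
    have h := hkey ε hε hερ hεr hεδ
    have h1 : K₂ * ε ^ 2 * v₁ ≤ η := by
      have h2 : ε ^ 2 ≤ ε := by nlinarith
      have h3 : K₂ * ε ^ 2 * v₁ ≤ (K₂ * v₁ + 1) * ε := by nlinarith [mul_nonneg hK₂0 hv₁0]
      have h4 : (K₂ * v₁ + 1) * ε ≤ η := by
        rw [← le_div_iff₀' hKv]; exact hεη
      linarith
    have h5 : (Real.exp (2 * n * ℓo) * K₁ + K₂ * ε ^ 2) * v₁ =
        Real.exp (2 * n * ℓo) * K₁ * v₁ + K₂ * ε ^ 2 * v₁ := by ring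
    linarith
  -- compare the two levels and divide by the weight
  have hexp : Real.exp (2 * n * ℓo) ≤ Real.exp (2 * n * ℓA) :=
    exp_weight_le hn0.le (outer_le_inner_level hρ hρ1)
  have hpos : 0 < Real.exp (2 * n * ℓA) := Real.exp_pos _
  have h1 : Real.exp (2 * n * ℓA) * (2 * n * I) ≤ Real.exp (2 * n * ℓA) * (K₁ * v₁) := by
    calc Real.exp (2 * n * ℓA) * (2 * n * I) = 2 * n * Real.exp (2 * n * ℓA) * I := by ring
      _ ≤ Real.exp (2 * n * ℓo) * K₁ * v₁ := hlim
      _ ≤ Real.exp (2 * n * ℓA) * K₁ * v₁ :=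
          mul_le_mul_of_nonneg_right (mul_le_mul_of_nonneg_right hexp hK₁0) hv₁0
      _ = Real.exp (2 * n * ℓA) * (K₁ * v₁) := by ring
  have := le_of_mul_le_mul_left h1 hpos
  linarith

set_option maxHeartbeats 800000 in
/-- **Strong unique continuation for `‖∂ₓw + J∂ᵧw‖ ≤ M ‖w‖` (Carleman 1939; Aronszajn 1957;
McDuff 1991 Lemma 2.3).** A `C²` solution on a disc of the differential inequality
`‖∂ₓw + J∂ᵧw‖ ≤ M ‖w‖` (`J² = -1`, values in a real inner product space) which vanishes to
infinite order at a point `z₀` of the disc (`‖w z‖ ≤ C_N ‖z - z₀‖^N` near `z₀`, for every `N`)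
vanishes identically on the disc. Proof: Carleman's weighted `L²` method with the weights
`(ε⁴ + ‖z - z₀‖²)^{-n} e^{2n‖z - z₀‖²}` (`key_estimate`, `annulus_mass_le`: the mass of `w` on each
annulus `r₁ ≤ ‖z - z₀‖ ≤ ρ/8` is `O(1/n)`, hence zero), then the weak unique continuation theorem
`eq_zero_on_ball`. [folklore] -/
theorem eq_zero_on_ball_of_flat (hJ : ∀ v, J (J v) = -v) {c : ℂ} {r : ℝ} {w : ℂ → V}
    (hw : ContDiffOn ℝ 2 w (ball c r)) {M : ℝ}
    (hM : ∀ z ∈ ball c r, ‖Dop J w z‖ ≤ M * ‖w z‖) {z₀ : ℂ} (hz₀ : z₀ ∈ ball c r)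
    (hflat : ∀ N : ℕ, ∃ C δ : ℝ, 0 < δ ∧ ∀ z, ‖z - z₀‖ < δ → ‖w z‖ ≤ C * ‖z - z₀‖ ^ N) :
    ∀ z ∈ ball c r, w z = 0 := by
  -- ### set-up: a radius `ρ ≤ 1/2` with `closedBall z₀ ρ ⊆ ball c r`, and the constants
  have hM' : ∀ z ∈ ball c r, ‖Dop J w z‖ ≤ max M 0 * ‖w z‖ := fun z hz =>
    (hM z hz).trans (mul_le_mul_of_nonneg_right (le_max_left _ _) (norm_nonneg _))
  have hz₀' : dist z₀ c < r := mem_ball.mp hz₀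
  set ρ : ℝ := min ((r - dist z₀ c) / 2) (1 / 2) with hρ_def
  have hρ : 0 < ρ := lt_min (by linarith) (by norm_num)
  have hρ1 : ρ ≤ 1 / 2 := min_le_right _ _
  have hρU : closedBall z₀ ρ ⊆ ball c r := by
    intro y hy
    rw [mem_closedBall] at hy
    rw [mem_ball]
    have h1 : ρ ≤ (r - dist z₀ c) / 2 := min_le_left _ _
    linarith [dist_triangle y z₀ c]
  obtain ⟨A, hA⟩ := (isCompact_closedBall z₀ ρ).exists_bound_of_continuousOn
    (hw.continuousOn.mono hρU)
  let χo : ContDiffBump z₀ := ⟨ρ / 2, ρ, by positivity, by linarith⟩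
  have hχoc : Continuous (fderiv ℝ (χo : ℂ → ℝ)) :=
    (χo.contDiff (n := 1)).continuous_fderiv one_ne_zero
  obtain ⟨Co, hCo⟩ := hχoc.bounded_above_of_compact_support (χo.hasCompactSupport.fderiv ℝ)
  have hCo' : ∀ y v, ‖fderiv ℝ (χo : ℂ → ℝ) y v‖ ≤ max Co 0 * ‖v‖ := fun y v =>
    ((fderiv ℝ (χo : ℂ → ℝ) y).le_opNorm v).trans
      (mul_le_mul_of_nonneg_right ((hCo y).trans (le_max_left _ _)) (norm_nonneg _))
  obtain ⟨Cβ, hCβ0, hCβ⟩ := exists_scaledBump_fderiv_bound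
  -- ### the mass of `w` on every annulus `r₁ ≤ ‖z - z₀‖ ≤ ρ/8` vanishes
  set K : ℝ := 2 * (1 + ‖J‖ ^ 2) * ((1 + ‖J‖) * max Co 0 * A) ^ 2 *
    (volume (closedBall z₀ (1 : ℝ))).toReal with hK
  have hK0 : 0 ≤ K := by
    have : 0 ≤ (volume (closedBall z₀ (1 : ℝ))).toReal := ENNReal.toReal_nonneg
    positivity
  have hmass : ∀ r₁ : ℝ, 0 < r₁ →
      ∫ z in closedBall z₀ (ρ / 8) \ ball z₀ r₁, Nf J (w z) = 0 := by
    intro r₁ hr₁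
    set I : ℝ := ∫ z in closedBall z₀ (ρ / 8) \ ball z₀ r₁, Nf J (w z) with hI
    have hI0 : 0 ≤ I :=
      setIntegral_nonneg (measurableSet_closedBall.diff measurableSet_ball) fun y _ =>
        Nf_nonneg J _
    have hbound : ∀ n : ℕ, 1 ≤ n → 2 * (1 + ‖J‖ ^ 2) * max M 0 ^ 2 ≤ 2 * n → 2 * n * I ≤ K :=
      fun n hn hna => annulus_mass_le hJ isOpen_ball hw hM' hρ hρ1 hρU hA χo rfl rfl
        (le_max_right _ _) hCo' hCβ0 (hCβ z₀) hflat n hn hna hr₁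
    refine le_antisymm ?_ hI0
    refine le_of_forall_pos_le_add fun η hη => ?_
    rw [zero_add]
    -- choose `n` with `n ≥ 1`, `(1 + ‖J‖²) M² ≤ n` and `K < 2 n η`
    obtain ⟨n, hn⟩ := exists_nat_gt (max (max 1 ((1 + ‖J‖ ^ 2) * max M 0 ^ 2)) (K / (2 * η)))
    have hn1 : (1 : ℝ) ≤ n := ((le_max_left _ _).trans (le_max_left _ _)).trans hn.le
    have hn1' : 1 ≤ n := by exact_mod_cast hn1
    have hna : 2 * (1 + ‖J‖ ^ 2) * max M 0 ^ 2 ≤ 2 * n := by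
      have := ((le_max_right _ _).trans (le_max_left _ _)).trans hn.le
      linarith
    have hnK : K / (2 * η) < n := (le_max_right _ _).trans_lt hn
    have h := hbound n hn1' hna
    have h2 : K < 2 * n * η := by
      rw [div_lt_iff₀ (by positivity)] at hnK; linarith
    by_contra hcon
    push Not at hcon
    have : 2 * n * η < 2 * n * I := by
      have hn0 : (0 : ℝ) < 2 * n := by positivity
      exact mul_lt_mul_of_pos_left hcon hn0
    linarith
  -- ### hence `w = 0` on `ball z₀ (ρ / 8)`
  have hwc : ContinuousOn w (ball c r) := hw.continuousOn
  have hzero : ∀ z ∈ ball z₀ (ρ / 8), w z = 0 := by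
    intro z hz
    by_cases hzz : z = z₀
    · subst hzz
      obtain ⟨C, δ, hδ, hC⟩ := hflat 1
      have := hC z (by simpa using hδ)
      simpa using this
    by_contra hwz
    have hs : 0 < ‖z - z₀‖ := norm_pos_iff.mpr (sub_ne_zero.mpr hzz)
    have hsρ : ‖z - z₀‖ < ρ / 8 := by rwa [mem_ball, dist_eq_norm] at hz
    -- a small ball around `z` inside the annulus `‖z - z₀‖/2 ≤ ‖y - z₀‖ ≤ ρ/8`
    set s : ℝ := ‖z - z₀‖ with hs_def
    set t : ℝ := min (s / 2) (ρ / 8 - s) / 2 with ht_def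
    have ht : 0 < t := by
      rw [ht_def]; exact div_pos (lt_min (by linarith) (by linarith)) two_pos
    have hts : t < s / 2 := by
      have := min_le_left (s / 2) (ρ / 8 - s); rw [ht_def]; linarith
    have htρ : t < ρ / 8 - s := by
      have := min_le_right (s / 2) (ρ / 8 - s); rw [ht_def]; linarith
    set Ann : Set ℂ := closedBall z₀ (ρ / 8) \ ball z₀ (s / 2) with hAnn
    have hAnnm : MeasurableSet Ann := measurableSet_closedBall.diff measurableSet_ball
    have hzU : z ∈ ball c r := hρU (mem_closedBall.mpr (by rw [dist_eq_norm]; linarith))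
    have hAnnU : Ann ⊆ ball c r := fun y hy =>
      hρU (closedBall_subset_closedBall (by linarith) hy.1)
    -- positivity of `N(w)` near `z`
    have hNz : 0 < Nf J (w z) := by
      have := sq_norm_le_Nf J (w z)
      have h0 : 0 < ‖w z‖ := norm_pos_iff.mpr hwz
      nlinarith
    have hcont : ContinuousAt (fun y => Nf J (w y)) z :=
      ((continuous_Nf J continuous_id).continuousAt).comp
        (hwc.continuousAt (isOpen_ball.mem_nhds hzU))
    obtain ⟨t', ht', hball⟩ := Metric.eventually_nhds_iff_ball.mp
      (hcont.eventually (lt_mem_nhds (show Nf J (w z) / 2 < Nf J (w z) by linarith)))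
    set t₀ : ℝ := min t t' with ht₀_def
    have ht₀ : 0 < t₀ := lt_min ht ht'
    have hBsub : ball z t₀ ⊆ Ann := by
      intro y hy
      rw [mem_ball, dist_eq_norm] at hy
      have hy1 : ‖y - z‖ < t := hy.trans_le (min_le_left _ _)
      rw [hAnn, Set.mem_sdiff, mem_closedBall, mem_ball, not_lt, dist_eq_norm]
      constructor
      · linarith [norm_sub_le_norm_sub_add_norm_sub y z z₀]
      · linarith [norm_sub_le_norm_sub_add_norm_sub z y z₀, norm_sub_rev z y]
    have hBpos : ∀ y ∈ ball z t₀, Nf J (w z) / 2 ≤ Nf J (w y) := fun y hy =>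
      (hball y (ball_subset_ball (min_le_right _ _) hy)).le
    -- the integral over the small ball is positive, contradicting `hmass`
    have hwAnn : ContinuousOn (fun y => Nf J (w y)) Ann :=
      (continuous_Nf J continuous_id).comp_continuousOn (hwc.mono hAnnU)
    have hAnnc : IsCompact Ann := (isCompact_closedBall z₀ (ρ / 8)).diff isOpen_ball
    have iA : IntegrableOn (fun y => Nf J (w y)) Ann := hwAnn.integrableOn_compact hAnnc
    have h1 : ∫ y in ball z t₀, Nf J (w y) ≤ ∫ y in Ann, Nf J (w y) :=
      setIntegral_mono_set iA (Eventually.of_forall fun y => Nf_nonneg J _)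
        (Eventually.of_forall hBsub)
    have hvol : 0 < volume.real (ball z t₀) :=
      ENNReal.toReal_pos (measure_ball_pos volume z ht₀).ne' measure_ball_lt_top.ne
    have h2 : Nf J (w z) / 2 * volume.real (ball z t₀) ≤ ∫ y in ball z t₀, Nf J (w y) := by
      have h3 : ∫ y in ball z t₀, Nf J (w z) / 2 ≤ ∫ y in ball z t₀, Nf J (w y) :=
        setIntegral_mono_on (integrableOn_const measure_ball_lt_top.ne) (iA.mono_set hBsub)
          measurableSet_ball hBpos
      rw [setIntegral_const, smul_eq_mul, mul_comm] at h3
      exact h3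
    have h4 : 0 < Nf J (w z) / 2 * volume.real (ball z t₀) := mul_pos (by linarith) hvol
    have h5 := hmass (s / 2) (by linarith)
    rw [← hAnn] at h5
    linarith
  -- ### weak unique continuation spreads the zeros over the disc
  exact eq_zero_on_ball hJ hw hM hz₀ (Filter.eventually_of_mem
    (isOpen_ball.mem_nhds (mem_ball_self (by positivity))) hzero)

end Strong

end FlatUniqueContinuation

/-! ### Strong unique continuation for flat `J`-holomorphic discs -/

open FlatUniqueContinuation in
/-- **McDuff 1991, Lemma 2.3 (strong form, flat): a `J`-holomorphic disc agreeing to infinite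
order with a constant is constant.** Let `T ⊆ ℝ⁴` be open (here: any real inner product space
`F`), `Jc` a `C^∞` field of complex structures on `T` (`Jc(y)² = -1`), and `u` of class `C^∞` on
`ball c r`, mapping it into `T` and `Jc`-holomorphic there (`Du(z)(iζ) = Jc(u z)(Du(z) ζ)`). If
`u - u z₀` vanishes to infinite order at some `z₀ ∈ ball c r` (`‖u z - u z₀‖ ≤ C_N ‖z - z₀‖^N`
near `z₀`, for every `N`), then `u z = u z₀` on the whole disc. McDuff: "If two `J`-holomorphic
curves `f, f'` have the same `∞`-jet at a point `z` of a connected Riemann surface, then `f = f'`"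
(applied to `u` and the constant curve), there via Aronszajn's theorem; here via Carleman's
weighted `L²` method (`FlatUniqueContinuation.eq_zero_on_ball_of_flat`): in coordinates
`w = u - u z₀` solves `∂ₓw + J∂ᵧw = J (Jc(u) - J) ∂ₓu`, `J = Jc (u z₀)`, so `‖∂ₓw + J∂ᵧw‖ ≤ M ‖w‖`
on every smaller disc. [cite: McDuff1991LocalBehaviour, Lemma 2.3] -/
theorem jHolomorphicFlat_eq_of_vanish_infiniteOrder {F : Type*} [NormedAddCommGroup F]
    [InnerProductSpace ℝ F] {T : Set F} (hT : IsOpen T) {Jc : F → F →L[ℝ] F}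
    (hJc : ContDiffOn ℝ ∞ Jc T) (hJ2 : ∀ y ∈ T, ∀ v : F, Jc y (Jc y v) = -v) {c : ℂ} {r : ℝ}
    {u : ℂ → F} (hu : ContDiffOn ℝ ∞ u (Metric.ball c r)) (huT : Set.MapsTo u (Metric.ball c r) T)
    (hhol : ∀ z ∈ Metric.ball c r, ∀ ζ : ℂ,
      fderiv ℝ u z (Complex.I * ζ) = Jc (u z) (fderiv ℝ u z ζ))
    {z₀ : ℂ} (hz₀ : z₀ ∈ Metric.ball c r)
    (hflat : ∀ N : ℕ, ∃ C δ : ℝ, 0 < δ ∧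
      ∀ z, ‖z - z₀‖ < δ → ‖u z - u z₀‖ ≤ C * ‖z - z₀‖ ^ N) :
    ∀ z ∈ Metric.ball c r, u z = u z₀ := by
  intro z hz
  -- a smaller closed disc containing `z` and `z₀`
  obtain ⟨r', hr'1, hr'2⟩ := exists_between (max_lt (mem_ball.mp hz) (mem_ball.mp hz₀))
  have hzr' : dist z c < r' := lt_of_le_of_lt (le_max_left _ _) hr'1
  have hz₀r' : dist z₀ c < r' := lt_of_le_of_lt (le_max_right _ _) hr'1
  set p₀ := u z₀ with hp₀_def
  have hp₀T : p₀ ∈ T := huT hz₀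
  set J : F →L[ℝ] F := Jc p₀ with hJ_def
  have hJ : ∀ v, J (J v) = -v := hJ2 p₀ hp₀T
  set w : ℂ → F := fun y => u y - p₀ with hw_def
  -- compact sets
  set K : Set ℂ := closedBall c r' with hK_def
  have hK : IsCompact K := isCompact_closedBall _ _
  have hKB : K ⊆ ball c r := closedBall_subset_ball hr'2
  have huc : ContinuousOn u (ball c r) := hu.continuousOn
  have hK' : IsCompact (u '' K) := hK.image_of_continuousOn (huc.mono hKB)
  have hK'T : u '' K ⊆ T := by
    rintro _ ⟨y, hy, rfl⟩; exact huT (hKB hy)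
  have hz₀K : z₀ ∈ K := mem_closedBall.mpr hz₀r'.le
  -- the Lipschitz-type constant for `Jc` relative to `p₀`
  obtain ⟨L, hL0, hL⟩ := exists_norm_sub_le_mul_of_contDiffOn hT (hJc.of_le (by norm_num)) hK'
    hK'T (mem_image_of_mem u hz₀K)
  -- a bound for `∂ₓ u` on `K`
  have hfd : ContinuousOn (fderiv ℝ u) (ball c r) :=
    hu.continuousOn_fderiv_of_isOpen isOpen_ball (by norm_num)
  obtain ⟨A, hA⟩ := hK.exists_bound_of_continuousOn (hfd.mono hKB)
  have hA0 : 0 ≤ A := le_trans (norm_nonneg _) (hA z₀ hz₀K)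
  -- the differential inequality on `ball c r'`
  set M : ℝ := ‖J‖ * L * A with hM_def
  have hM : ∀ y ∈ ball c r', ‖Dop J w y‖ ≤ M * ‖w y‖ := by
    intro y hy
    have hyK : y ∈ K := ball_subset_closedBall hy
    have hyB : y ∈ ball c r := hKB hyK
    have e1 : fderiv ℝ w y = fderiv ℝ u y := by
      rw [hw_def]; exact fderiv_sub_const _
    have e2 : dY u y = Jc (u y) (dX u y) := by
      have := hhol y hyB 1
      rw [mul_one] at this
      exact this
    have e3 : Dop J w y = J ((Jc (u y) - J) (dX u y)) := by
      simp only [Dop, dX, dY, e1] at e2 ⊢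
      rw [e2]
      simp only [sub_apply, map_sub, hJ]
      abel
    rw [e3]
    have h1 : ‖dX u y‖ ≤ A := by
      have := (fderiv ℝ u y).le_opNorm (1 : ℂ)
      rw [norm_one, mul_one] at this
      exact this.trans (hA y hyK)
    have h2 : ‖Jc (u y) - J‖ ≤ L * ‖w y‖ := hL (u y) (mem_image_of_mem u hyK)
    calc ‖J ((Jc (u y) - J) (dX u y))‖ ≤ ‖J‖ * ‖(Jc (u y) - J) (dX u y)‖ := J.le_opNorm _
      _ ≤ ‖J‖ * (‖Jc (u y) - J‖ * ‖dX u y‖) :=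
          mul_le_mul_of_nonneg_left ((Jc (u y) - J).le_opNorm _) (norm_nonneg _)
      _ ≤ ‖J‖ * (L * ‖w y‖ * A) := by
          refine mul_le_mul_of_nonneg_left ?_ (norm_nonneg _)
          exact mul_le_mul h2 h1 (norm_nonneg _) (mul_nonneg hL0 (norm_nonneg _))
      _ = M * ‖w y‖ := by rw [hM_def]; ring
  -- regularity of `w`, flatness at `z₀`, strong unique continuation
  have hw2 : ContDiffOn ℝ 2 w (ball c r') :=
    ((hu.sub contDiffOn_const).of_le (by norm_cast)).mono (ball_subset_ball hr'2.le)
  have hflat' : ∀ N : ℕ, ∃ C δ : ℝ, 0 < δ ∧ ∀ y, ‖y - z₀‖ < δ → ‖w y‖ ≤ C * ‖y - z₀‖ ^ N := by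
    intro N
    obtain ⟨C, δ, hδ, hC⟩ := hflat N
    exact ⟨C, δ, hδ, fun y hy => by simpa [hw_def, hp₀_def] using hC y hy⟩
  have := eq_zero_on_ball_of_flat hJ hw2 hM (mem_ball.mpr hz₀r') hflat' z (mem_ball.mpr hzr')
  simpa [hw_def, sub_eq_zero] using this

end Literature.Geometry.Symplectic
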